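import Summits.QuantumFields.YangMills.Theorems.FlatTubeReductionFPWeightPointwise
import Summits.QuantumFields.YangMills.Theorems.LuscherReductionTwistedTraceScalingFPWeightCore
import HarnessLib

/-!
# The Faddeev–Popov weight POINTWISE, eventually in `β`: `|N(U)/N̄(s) − 1| ≤ C·(r(β) + s(β)² + τ_U²)` on the fat tube, `τ_U` the link deviation of `U` itself — F9d of the
# (N)-POINTWISE-AT-RATE brick
# (route `FlatTubeReduction`, crux K1 `NearFlatRatioLaw` stmt-QuantumFields-24720; seat `ym-line-ftr-p1` g14; rate twin «ratepack-v3 / frozen fibres»; R2b1 RECORD rung — no summit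
# statement is proved here; template = RED lane A's `…FPWeightCore.fpWeight_core_constant` for crux 20203)

WHY (memo `Cruxes/NearFlatRatioLaw/Lines/ratepack-v3-frozen-g12.md` §8.1).  `fpWeight_pointwise_at` (p707992) is the deterministic statement; here the lineage constants are
produced (`exists_slicePoint`, `exists_taylor_two_basedFn`, `exists_uniform_coercive_basedLin`, `laplaceIntegral_eq`, `exists_gramDet_ratio_bound`,
`eventually_norm_basedLin_sub_le`), every smallness hypothesis is discharged eventually in `β` for scales `δ → 0`, `0 < δg ≤ δ`, a core radius `0 ≤ r ≤ δ²` whose Gaussian tail is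
`≤ r`, and the two-sided bound is relaxed to the symmetric form `N̄(s)(1 − C(r + s² + τ²)) ≤ N(U) ≤ N̄(s)(1 + C(r + s² + τ²))` with ONE constant `C = C(L, M)`.
  ★★★ `fpWeight_pointwise_eventually`.
HONEST FRAMING: bookkeeping on lane A's landed (N2) tool-chain; the fibre instance `U = orthoTube u v` and the mass ratio (F9e) remain; femto rung R2b1 (RECORD label); not infinite volume,
not a gap, not Clay.  No defs, no named facts, no `sorry`.
-/

set_option autoImplicit false

noncomputable section

open MeasureTheory Filter Topology Real Module
open scoped BigOperators
open Literature.MathematicalPhysics.QuantumFieldTheory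
open Literature.MathematicalPhysics.QuantumLattice

namespace Summit.QuantumFields.YangMills.Theorems.FemtoTransferGap.TwoLattice.ConstTube

open Summit.QuantumFields.YangMills.Theorems.FemtoTransferGap
open Summit.QuantumFields.YangMills.Theorems.FemtoTransferGap.TwoLattice.Avg
open Summit.QuantumFields.YangMills.Theorems.FemtoTransferGap.TwoLattice.Stiff (LinkSpace)

variable (L : ℕ) [NeZero L]

/-- The lower relaxation: `0 ≤ X ≤ C₀(r + s²)`, `0 ≤ Y ≤ C₀τ²` ⇒ `1 − 2C₀(r + s² + τ²) ≤ (1 − X)(1 − Y)` (for `0 ≤ C₀`, `0 ≤ r + s² + τ²`). [folklore] -/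
theorem one_sub_le_mul_one_sub {X Y C₀ r s2 τ2 : ℝ} (hX0 : 0 ≤ X) (hY0 : 0 ≤ Y) (hX : X ≤ C₀ * (r + s2)) (hY : Y ≤ C₀ * τ2) (hC : 0 ≤ C₀) (hsum : 0 ≤ r + s2 + τ2) :
    1 - 2 * C₀ * (r + s2 + τ2) ≤ (1 - X) * (1 - Y) := by
  have e : (1 - X) * (1 - Y) = 1 - X - Y + X * Y := by ring
  have hXY := mul_nonneg hX0 hY0
  have := mul_nonneg hC hsum
  rw [e]; linarith

/-- The upper relaxation: `0 ≤ X ≤ C₀ r`, `0 ≤ Y ≤ min(C₀τ², ½)` ⇒ `(1 + X)(1 + Y) ≤ 1 + 2C₀(r + s² + τ²)` (for `0 ≤ C₀`, `0 ≤ r, s², τ²`). [folklore] -/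
theorem mul_one_add_le_one_add {X Y C₀ r s2 τ2 : ℝ} (hX0 : 0 ≤ X) (hX : X ≤ C₀ * r) (hY : Y ≤ C₀ * τ2) (hY2 : Y ≤ 1 / 2) (hC : 0 ≤ C₀) (hr : 0 ≤ r) (hs : 0 ≤ s2) (hτ : 0 ≤ τ2) :
    (1 + X) * (1 + Y) ≤ 1 + 2 * C₀ * (r + s2 + τ2) := by
  have e : (1 + X) * (1 + Y) = 1 + X + Y + X * Y := by ring
  have hXY : X * Y ≤ X * (1 / 2) := mul_le_mul_of_nonneg_left hY2 hX0
  have := mul_nonneg hC hr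
  have := mul_nonneg hC hs
  have := mul_nonneg hC hτ
  rw [e]; linarith

set_option maxHeartbeats 1600000 in
/-- ★★★ **THE FP WEIGHT POINTWISE, EVENTUALLY IN `β`.**  Scales `δ → 0` (`0 < δ`), `0 < δg ≤ δ` eventually, fat radius `M·δ` (`M ≥ M₀(L)`), a core radius `r` with `0 ≤ r ≤ δ²` and
`4^{d/2}·exp(−c²r²/(4δg²)) ≤ r` eventually (`c = 1/(4·sliceConst L)`).  Then there are `C ≥ 0` and `β₀` such that for `β ≥ β₀`, every `U` in the fat tube and every `0 < τ ≤ δ β` with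
`‖U_e − 1‖_F ≤ τ` for all `e`:  `N̄(δg β)·(1 − C(r β + δg β² + τ²)) ≤ N(U) ≤ N̄(δg β)·(1 + C(r β + δg β² + τ²))`. [cite: Luscher1983, §3] -/
theorem fpWeight_pointwise_eventually (hL : Nonempty (NzSite L)) {δ δg r : ℝ → ℝ} (hδ0 : ∀ β, 0 < δ β) (hδ : Tendsto δ atTop (𝓝 0))
    (hsd : ∀ᶠ β in atTop, 0 < δg β ∧ δg β ≤ δ β) (hr : ∀ᶠ β in atTop, 0 ≤ r β ∧ r β ≤ δ β ^ 2)
    (htail : ∀ᶠ β in atTop, (4 : ℝ) ^ (flatDim L / 2 : ℝ) * Real.exp (-((1 / (4 * sliceConst L)) ^ 2 * r β ^ 2 / (4 * δg β ^ 2))) ≤ r β) :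
    ∃ M₀ : ℝ, 2 ≤ M₀ ∧ ∀ M : ℝ, M₀ ≤ M → ∃ C β₀ : ℝ, 0 ≤ C ∧ ∀ β : ℝ, β₀ ≤ β →
      ∀ U ∈ fatTubeRho L δ (fun b => M * δ b) β, ∀ τ : ℝ, 0 < τ → τ ≤ δ β →
        (∀ e : Edge 3 L, frobNorm (((U e : SU2) : Matrix (Fin 2) (Fin 2) ℂ) - 1) ≤ τ) →
        fpWeightBar L (δg β) * (1 - C * (r β + δg β ^ 2 + τ ^ 2)) ≤ gaugeAvg (recordWeightRho L δ (fun b => M * δ b) δg β) U ∧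
          gaugeAvg (recordWeightRho L δ (fun b => M * δ b) δg β) U ≤ fpWeightBar L (δg β) * (1 + C * (r β + δg β ^ 2 + τ ^ 2)) := by
  -- the constants of the lineage (as in `fpWeight_core_constant`)
  obtain ⟨K, ε, hK, hε, hSP⟩ := exists_slicePoint L
  obtain ⟨M_T, ε_T, hMT, hεT, hT⟩ := exists_taylor_two_basedFn L
  obtain ⟨ε_C, hεC, hC⟩ := exists_uniform_coercive_basedLin L
  obtain ⟨ε_I, hεI, hI'⟩ := Metric.eventually_nhds_iff.mp (laplaceIntegral_eq L)
  have hI : ∀ q : balancedSubmodule L × (Fin 3 → Fin 3 → ℝ), ‖q‖ < ε_I → ∀ {a s : ℝ}, 0 < a → 0 < s →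
      ∫ w, Real.exp (-(a * ‖laplaceMap L q w‖ ^ 2 / s ^ 2)) ∂(volume : Measure (NzSite L → Fin 3 → ℝ)) =
        (π * s ^ 2 / a) ^ (finrank ℝ (EuclideanSpace ℝ (NzSite L × Fin 3)) / 2 : ℝ) / Real.sqrt (gramDet L q) :=
    fun q hq => hI' (by rwa [dist_zero_right])
  obtain ⟨K_D, ε_D, hKD, hεD, hD⟩ := exists_gramDet_ratio_bound L
  obtain ⟨ε_B', hεB', hball⟩ := Metric.eventually_nhds_iff.mp (eventually_norm_basedLin_sub_le L)
  set RB : ℝ := 1144 * Real.sqrt (3 * Fintype.card (Edge 3 L)) with hRB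
  have hRB0 : 0 ≤ RB := by rw [hRB]; positivity
  set ε_B : ℝ := min ε_B' (1 / (RB + 1)) with hεBdef
  have hεB : 0 < ε_B := lt_min hεB' (by positivity)
  set B : ℝ := ‖basedLin L 0‖ + 1 with hBdef
  have hB0 : 0 ≤ B := by positivity
  have hB : ∀ q : balancedSubmodule L × (Fin 3 → Fin 3 → ℝ), ‖q‖ < ε_B → ‖basedLin L q‖ ≤ B := fun q hq => by
    have hq1 : ‖q‖ < ε_B' := lt_of_lt_of_le hq (min_le_left _ _)
    have hq2 : ‖q‖ < 1 / (RB + 1) := lt_of_lt_of_le hq (min_le_right _ _)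
    have hop : ‖basedLin L q - basedLin L 0‖ ≤ RB * ‖q‖ :=
      ContinuousLinearMap.opNorm_le_bound _ (by positivity) fun ξ => by
        have := hball (by rwa [dist_zero_right]) ξ; rw [hRB]; linarith
    have hRq : RB * ‖q‖ ≤ 1 := by
      have h1 : RB * ‖q‖ ≤ RB * (1 / (RB + 1)) := mul_le_mul_of_nonneg_left hq2.le hRB0
      have h2 : RB * (1 / (RB + 1)) ≤ 1 := by rw [mul_one_div, div_le_one (by positivity)]; linarith
      exact h1.trans h2
    have h3 := norm_le_insert' (basedLin L q) (basedLin L 0)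
    rw [hBdef]; linarith
  have hCpos := sliceConst_pos L
  refine ⟨3 + 16 * K, by linarith, fun M hM => ?_⟩
  -- the constant: `A = 12C_L(M_T+2B)`, `S = 96nC_L²`, `K' = K_D(2+32K)²`, `C₀ = (d/2)A + 1 + (d/2)S + K' + 4(d/2)A`, `C = 2C₀`
  set d2 : ℝ := (flatDim L / 2 : ℝ) with hd2
  have hd2_0 : 0 ≤ d2 := by rw [hd2]; positivity
  set A : ℝ := 12 * sliceConst L * (M_T + 2 * B) with hAdef
  have hA0 : 0 ≤ A := by rw [hAdef]; positivity
  set Sg : ℝ := 96 * (Fintype.card (NzSite L) : ℝ) * sliceConst L ^ 2 with hSgdef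
  have hSg0 : 0 ≤ Sg := by rw [hSgdef]; positivity
  set K' : ℝ := K_D * (2 + 32 * K) ^ 2 with hK'def
  have hK'0 : 0 ≤ K' := by rw [hK'def]; positivity
  set C₀ : ℝ := d2 * A + 1 + d2 * Sg + K' + 4 * d2 * A with hC₀def
  have hC₀0 : 0 ≤ C₀ := by rw [hC₀def]; positivity
  -- eventually all smallness conditions hold
  have ev : ∀ᶠ β in atTop, ∀ U ∈ fatTubeRho L δ (fun b => M * δ b) β, ∀ τ : ℝ, 0 < τ → τ ≤ δ β →
      (∀ e : Edge 3 L, frobNorm (((U e : SU2) : Matrix (Fin 2) (Fin 2) ℂ) - 1) ≤ τ) →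
        fpWeightBar L (δg β) * (1 - 2 * C₀ * (r β + δg β ^ 2 + τ ^ 2)) ≤ gaugeAvg (recordWeightRho L δ (fun b => M * δ b) δg β) U ∧
          gaugeAvg (recordWeightRho L δ (fun b => M * δ b) δg β) U ≤ fpWeightBar L (δg β) * (1 + 2 * C₀ * (r β + δg β ^ 2 + τ ^ 2)) := by
    filter_upwards [hδ.eventually (eventually_le_nhds (by norm_num : (0:ℝ) < 1 / 8)), hδ.eventually (eventually_le_nhds (by positivity : (0:ℝ) < ε / 4)),
      eventually_mul_le_of_tendsto hδ (2 * K) (by norm_num : (0:ℝ) < 1 / 2), eventually_mul_le_of_tendsto hδ (1 + 16 * K) (by norm_num : (0:ℝ) < 1 / 4),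
      eventually_mul_lt_of_tendsto hδ (2 + 32 * K) hεT, eventually_mul_lt_of_tendsto hδ (2 + 32 * K) hεC, eventually_mul_lt_of_tendsto hδ (2 + 32 * K) hεI,
      eventually_mul_lt_of_tendsto hδ (2 + 32 * K) hεD, eventually_mul_lt_of_tendsto hδ (2 + 32 * K) hεB,
      eventually_mul_le_of_tendsto hδ (2 + 32 * K) (by norm_num : (0:ℝ) < 1 / 40),
      eventually_mul_lt_of_tendsto hδ (3 * ((L : ℝ) - 1) * (2 + 16 * K + M) + 1) hεT,
      eventually_mul_le_of_tendsto hδ (4 * sliceConst L * (M_T + 2 * B) * (3 * ((L : ℝ) - 1) * (2 + 16 * K + M) + 1)) (by norm_num : (0:ℝ) < 1 / 4),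
      eventually_mul_le_of_tendsto hδ ((flatDim L / 2 + 1 : ℝ) * (12 * sliceConst L * (M_T + 2 * B))) (by norm_num : (0:ℝ) < 1 / 8),
      eventually_mul_le_of_tendsto hδ (6 * (Fintype.card (NzSite L) : ℝ) * (3 * ((L : ℝ) - 1) * (2 + 16 * K + M) + 1) ^ 2) one_pos,
      eventually_mul_le_of_tendsto hδ (K_D * (2 + 32 * K) ^ 2) (by norm_num : (0:ℝ) < 1 / 2),
      eventually_mul_le_of_tendsto hδ ((flatDim L / 2 + 1 : ℝ) * (96 * Fintype.card (NzSite L) * sliceConst L ^ 2)) (by norm_num : (0:ℝ) < 1 / 8),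
      hsd, hr, htail]
      with β h1 h2 h3 h4 h5 h6 h7 h8 h9 h10 h11 h12 h13 h15 h16 h17' hg hrβ htl4 U hU τ hτ0 hτt hUτ
    have ht0 := hδ0 β
    have ht1 : δ β ≤ 1 := by linarith only [h1]
    have hs0 := hg.1
    -- the `s²`-smallness `h17` from `δg ≤ δ ≤ 1`
    have hs2 : δg β ^ 2 ≤ δ β := by nlinarith only [hg.1, hg.2, ht1]
    have h17 : (flatDim L / 2 + 1 : ℝ) * (96 * Fintype.card (NzSite L) * sliceConst L ^ 2 * δg β ^ 2) ≤ 1 / 8 := by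
      have e : (flatDim L / 2 + 1 : ℝ) * (96 * Fintype.card (NzSite L) * sliceConst L ^ 2 * δg β ^ 2) =
          (flatDim L / 2 + 1 : ℝ) * (96 * Fintype.card (NzSite L) * sliceConst L ^ 2) * δg β ^ 2 := by ring
      have hc0 : 0 ≤ (flatDim L / 2 + 1 : ℝ) * (96 * Fintype.card (NzSite L) * sliceConst L ^ 2) := by positivity
      rw [e]; exact (mul_le_mul_of_nonneg_left hs2 hc0).trans h17'
    -- the tails: `T₂ ≤ T₄ ≤ r ≤ δ² ≤ 1/4`
    have hc2r : 0 ≤ (1 / (4 * sliceConst L)) ^ 2 * r β ^ 2 := by positivity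
    have hT24 : (2 : ℝ) ^ (flatDim L / 2 : ℝ) * Real.exp (-((1 / (4 * sliceConst L)) ^ 2 * r β ^ 2 / (2 * δg β ^ 2))) ≤
        (4 : ℝ) ^ (flatDim L / 2 : ℝ) * Real.exp (-((1 / (4 * sliceConst L)) ^ 2 * r β ^ 2 / (4 * δg β ^ 2))) := by
      refine mul_le_mul (Real.rpow_le_rpow (by norm_num) (by norm_num) hd2_0) (Real.exp_le_exp.mpr ?_) (Real.exp_pos _).le (by positivity)
      have hs2pos : 0 < 2 * δg β ^ 2 := by positivity
      have := div_le_div_of_nonneg_left hc2r hs2pos (by nlinarith only [sq_nonneg (δg β)] : 2 * δg β ^ 2 ≤ 4 * δg β ^ 2)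
      linarith only [this]
    have hT4_0 : 0 ≤ (4 : ℝ) ^ (flatDim L / 2 : ℝ) * Real.exp (-((1 / (4 * sliceConst L)) ^ 2 * r β ^ 2 / (4 * δg β ^ 2))) := by positivity
    have hT2_0 : 0 ≤ (2 : ℝ) ^ (flatDim L / 2 : ℝ) * Real.exp (-((1 / (4 * sliceConst L)) ^ 2 * r β ^ 2 / (2 * δg β ^ 2))) := by positivity
    have hrδ2 : r β ≤ δ β ^ 2 := hrβ.2
    have hδ2 : δ β ^ 2 ≤ 1 / 64 := by nlinarith only [h1, ht0]
    have htl : (2 : ℝ) ^ (flatDim L / 2 : ℝ) * Real.exp (-((1 / (4 * sliceConst L)) ^ 2 * r β ^ 2 / (2 * δg β ^ 2))) ≤ 1 / 4 := by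
      linarith only [hT24, htl4, hrδ2, hδ2]
    -- the deterministic pointwise bound
    obtain ⟨hlo, hhi⟩ := fpWeight_pointwise_at L hL hK hSP hMT hεT hT hC hI hKD hD hB0 hB hM rfl ht0 hs0
      h1 h2 h3 h4 h5 h6 h7 h8 h9 h10 h11 h12 h13 h15 h16 hτ0 hτt hrβ.1 hrδ2 htl h17 hU hUτ
    have hbar0 := (fpWeightBar_pos L hs0).le
    -- relax to the symmetric form
    have hτ2 : τ ^ 2 ≤ δ β := by nlinarith only [hτ0, hτt, ht1]
    have hY2 : K' * τ ^ 2 ≤ 1 / 2 := by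
      rw [hK'def]
      have := mul_le_mul_of_nonneg_left hτ2 (by positivity : 0 ≤ K_D * (2 + 32 * K) ^ 2)
      linarith only [this, h16]
    have hYC : K' * τ ^ 2 ≤ C₀ * τ ^ 2 := mul_le_mul_of_nonneg_right (by rw [hC₀def]; linarith only [hd2_0, hA0, hSg0, mul_nonneg hd2_0 hA0, mul_nonneg hd2_0 hSg0]) (sq_nonneg τ)
    have hY0 : 0 ≤ K' * τ ^ 2 := by positivity
    constructor
    · refine le_trans (mul_le_mul_of_nonneg_left ?_ hbar0) hlo
      have hX0 : 0 ≤ d2 * (A * r β + Sg * δg β ^ 2) + (2 : ℝ) ^ (flatDim L / 2 : ℝ) * Real.exp (-((1 / (4 * sliceConst L)) ^ 2 * r β ^ 2 / (2 * δg β ^ 2))) := by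
        have := hrβ.1; positivity
      have hX : d2 * (A * r β + Sg * δg β ^ 2) + (2 : ℝ) ^ (flatDim L / 2 : ℝ) * Real.exp (-((1 / (4 * sliceConst L)) ^ 2 * r β ^ 2 / (2 * δg β ^ 2))) ≤
          C₀ * (r β + δg β ^ 2) := by
        have e : C₀ * (r β + δg β ^ 2) = (d2 * A + 1) * r β + d2 * Sg * δg β ^ 2 + ((d2 * Sg + K' + 4 * d2 * A) * r β + (d2 * A + 1 + K' + 4 * d2 * A) * δg β ^ 2) := by
          rw [hC₀def]; ring
        have hextra : 0 ≤ (d2 * Sg + K' + 4 * d2 * A) * r β + (d2 * A + 1 + K' + 4 * d2 * A) * δg β ^ 2 := by have := hrβ.1; positivity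
        rw [e]; nlinarith only [hT24, htl4, hextra, hrβ.1, hd2_0, hA0, hSg0]
      have h := one_sub_le_mul_one_sub hX0 hY0 hX hYC hC₀0 (by have := hrβ.1; positivity : 0 ≤ r β + δg β ^ 2 + τ ^ 2)
      have e : (1 - (flatDim L / 2 : ℝ) * (12 * sliceConst L * (M_T + 2 * B) * r β + 96 * Fintype.card (NzSite L) * sliceConst L ^ 2 * δg β ^ 2) -
          (2 : ℝ) ^ (flatDim L / 2 : ℝ) * Real.exp (-((1 / (4 * sliceConst L)) ^ 2 * r β ^ 2 / (2 * δg β ^ 2)))) =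
          1 - (d2 * (A * r β + Sg * δg β ^ 2) + (2 : ℝ) ^ (flatDim L / 2 : ℝ) * Real.exp (-((1 / (4 * sliceConst L)) ^ 2 * r β ^ 2 / (2 * δg β ^ 2)))) := by
        rw [hd2, hAdef, hSgdef]; ring
      rw [e, hK'def.symm] ; exact h
    · refine hhi.trans (mul_le_mul_of_nonneg_left ?_ hbar0)
      have hX0 : 0 ≤ 4 * d2 * (A * r β) + (4 : ℝ) ^ (flatDim L / 2 : ℝ) * Real.exp (-((1 / (4 * sliceConst L)) ^ 2 * r β ^ 2 / (4 * δg β ^ 2))) := by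
        have := hrβ.1; positivity
      have hX : 4 * d2 * (A * r β) + (4 : ℝ) ^ (flatDim L / 2 : ℝ) * Real.exp (-((1 / (4 * sliceConst L)) ^ 2 * r β ^ 2 / (4 * δg β ^ 2))) ≤ C₀ * r β := by
        have e : C₀ * r β = 4 * d2 * (A * r β) + r β + (d2 * A + d2 * Sg + K') * r β := by rw [hC₀def]; ring
        have hextra : 0 ≤ (d2 * A + d2 * Sg + K') * r β := by have := hrβ.1; positivity
        rw [e]; linarith only [htl4, hextra]
      have h := mul_one_add_le_one_add (s2 := δg β ^ 2) (τ2 := τ ^ 2) hX0 hX hYC hY2 hC₀0 hrβ.1 (sq_nonneg _) (sq_nonneg _)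
      have e : (1 + 4 * (flatDim L / 2 : ℝ) * (12 * sliceConst L * (M_T + 2 * B) * r β) +
          (4 : ℝ) ^ (flatDim L / 2 : ℝ) * Real.exp (-((1 / (4 * sliceConst L)) ^ 2 * r β ^ 2 / (4 * δg β ^ 2)))) =
          1 + (4 * d2 * (A * r β) + (4 : ℝ) ^ (flatDim L / 2 : ℝ) * Real.exp (-((1 / (4 * sliceConst L)) ^ 2 * r β ^ 2 / (4 * δg β ^ 2)))) := by
        rw [hd2, hAdef]; ring
      rw [e, hK'def.symm]; exact h
  obtain ⟨β₀, hβ₀⟩ := Filter.eventually_atTop.mp ev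
  exact ⟨2 * C₀, β₀, by positivity, fun β hβ U hU τ hτ0 hτt hUτ => hβ₀ β hβ U hU τ hτ0 hτt hUτ⟩

end Summit.QuantumFields.YangMills.Theorems.FemtoTransferGap.TwoLattice.ConstTube

end
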